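import Summits.NavierStokesRegularity.FunctionalMining.TopBotEigSplitSharePlanarLine
import HarnessLib

/-!
# FunctionalMining — (W) at the planar share on the sector `[1/3, 2/3]` for EVERY real `1 < q ≤ 2`

HONEST FRAMING. Search for candidate a priori estimates; no regularity claim. One-variable real analysis (real
powers); nothing about Navier–Stokes. Cell `pub-nsfunc`, prove seat (gen 27); third file of the planar-share line
(`TopBotEigSplitSharePlanar` → `TopBotEigSplitSharePlanarLine` → this file → `TopBotEigSplitSharePlanarWindow`).

THE STEP. In the closed form `T/q² = (q − 1)(u(1 − u))^{q−2} + 3c²s^{q−2} − 3c(2 − q)(u^q + (1 − u)^q)s^{q/2−2}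
− 2c(q − 1)(u^{q−2} + (1 − u)^{q−2})s^{q/2−1}` (`lineT_closed_form`) at `c = c_pl(q) = ((q − 1)/3)·2^{1−q/2}`, bound the
third term by W2 (`u^q + (1 − u)^q ≤ 2^{1−q/2}s^{q/2}`) and `u^{q−2} + (1 − u)^{q−2}` by W1, but KEEP `s^{q/2−1}` and the
`c²` term exact. With `α = 2 − q`, `p = u(1 − u)`, `s = 2 − 6p` and `x = 2s ∈ [1, 4/3]` on the sector, what remains
after division by `(q − 1)p^{−α} > 0` is the one-variable inequality

  `f_α(x) := 1 + ((1 − 4α)/3)·((4 − x)/(3x))^α − (4(1 − α)/3)·x^{−α/2} ≥ 0`   on `[1, 4/3]`, `0 ≤ α ≤ 1`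

(`(4 − x)/(3x) = 2p/s`), which holds because `f_α(1) = 0` and `f_α′ ≥ 0` there: `f_α′ = α[(2(1 − α)/3)x^{−α/2−1} −
(4(1 − 4α)/9)x^{−2}((4 − x)/(3x))^{α−1}]`, and `x^{−2} ≤ x^{−α/2−1}` (`x ≥ 1`), `((4 − x)/(3x))^{α−1} ≤ (3/2)^{1−α} ≤ 3/2`
(`(4 − x)/(3x) ≥ 2/3`), `(4(1 − 4α)/9)(3/2) = 2(1 − 4α)/3 ≤ 2(1 − α)/3` (when `1 − 4α > 0`; trivial otherwise).

WHAT IS PROVED HERE [ours]: `planarF` (the function `f_α`), `planarF_one`, `hasDerivAt_planarF`,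
`deriv_planarF_nonneg`, `planarF_nonneg` (Mathlib `monotoneOn_of_deriv_nonneg`), and
**`lineT_cPlanar_nonneg_sector (hq : 1 < q) (hq2 : q ≤ 2) (hu1 : 1/3 < u) (hu2 : u < 2/3) : 0 ≤ lineT q (cPlanar q) u`**
— the third hypothesis (W) of K19's one-dimensional criterion at the planar share, for the whole range `1 < q ≤ 2`
(at `q = 2`, `c_pl = 1/3` and `T ≡ 0`, K20b `lineT_two`; the previous file's `lineT_cPlanar_nonneg` gives `q ≤ 7/4`
on all of `(0, 1)`).

NOT CLAIMED: (W) outside the sector for `7/4 < q < 2` (the `f_α`-minorant fails beyond `x = 4/3` for small `α`,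
`fcheck.py`; `T` itself READS positive on all of `(0, 1)` in floats — census-1 (cc.230) R1 — but that is neither proved
nor needed for K19);
anything about `heatDissipation`, `𝒦₀`, Navier–Stokes. Tree results used: K16 part 1 (`lineNsq`, `lineNsq_pos`,
`lineT`), `TopBotEigSplitSharePlanar` (`cPlanar`, `cPlanar_pos`), `TopBotEigSplitSharePlanarLine`
(`lineT_closed_form`, `sum_rpow_sub_two_le`, `sum_rpow_le_lineNsq`); Mathlib `HasDerivAt.rpow_const`,
`HasDerivAt.div`, `monotoneOn_of_deriv_nonneg`, `Real.rpow_le_rpow_of_nonpos`, `Real.rpow_le_rpow_of_exponent_ge/_le`.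
[ours] = this programme's own elementary work. search for candidate a priori estimates; no regularity claim.
-/

open Set Filter Topology

noncomputable section

namespace Summit.NavierStokesRegularity.FunctionalMining

namespace TopEig

/-! ## P5b. (W) at the planar share on the SECTOR `[1/3, 2/3]` for EVERY `1 < q ≤ 2`: keep the exact
`A²s^{q−2}` term and compare slopes of one function of `x = 2s ∈ [1, 4/3]` -/

/-- The one-variable comparison function `f_α(x) = 1 + ((1 − 4α)/3)·((4 − x)/(3x))^α − (4(1 − α)/3)·x^{−α/2}`
(`α = 2 − q`, `x = 2s`). [ours; bookkeeping] -/
def planarF (α x : ℝ) : ℝ := 1 + (1 - 4 * α) / 3 * ((4 - x) / (3 * x)) ^ α - 4 * (1 - α) / 3 * x ^ (-(α / 2))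

/-- `f_α(1) = 0`. [bookkeeping] -/
theorem planarF_one (α : ℝ) : planarF α 1 = 0 := by
  simp only [planarF, mul_one, show ((4 : ℝ) - 1) / 3 = 1 by norm_num, Real.one_rpow]; ring

/-- The derivative of `f_α` on `(0, 4)`. [bookkeeping] -/
theorem hasDerivAt_planarF (α : ℝ) {x : ℝ} (hx0 : 0 < x) (hx4 : x < 4) :
    HasDerivAt (planarF α)
      ((1 - 4 * α) / 3 * (-(4 / (3 * x ^ 2)) * α * ((4 - x) / (3 * x)) ^ (α - 1)) -
        4 * (1 - α) / 3 * (-(α / 2) * x ^ (-(α / 2) - 1))) x := by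
  have hr0 : 0 < (4 - x) / (3 * x) := div_pos (by linarith) (by linarith)
  have h1 : HasDerivAt (fun y : ℝ => (4 - y) / (3 * y)) (-(4 / (3 * x ^ 2))) x := by
    have hn : HasDerivAt (fun y : ℝ => 4 - y) (-1) x := by
      simpa using (hasDerivAt_id x).const_sub 4
    have hd : HasDerivAt (fun y : ℝ => 3 * y) 3 x := by
      simpa using (hasDerivAt_id x).const_mul 3
    refine (hn.div hd (by positivity : (3 : ℝ) * x ≠ 0)).congr_deriv ?_
    field_simp
    ring
  have h2 : HasDerivAt (fun y : ℝ => ((4 - y) / (3 * y)) ^ α)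
      (-(4 / (3 * x ^ 2)) * α * ((4 - x) / (3 * x)) ^ (α - 1)) x := h1.rpow_const (Or.inl hr0.ne')
  have h3 : HasDerivAt (fun y : ℝ => y ^ (-(α / 2))) (-(α / 2) * x ^ (-(α / 2) - 1)) x := by
    simpa using (hasDerivAt_id x).rpow_const (p := -(α / 2)) (Or.inl hx0.ne')
  have h := ((h2.const_mul ((1 - 4 * α) / 3)).const_add 1).sub (h3.const_mul (4 * (1 - α) / 3))
  have e : planarF α = fun y => 1 + (1 - 4 * α) / 3 * ((4 - y) / (3 * y)) ^ α -
      4 * (1 - α) / 3 * y ^ (-(α / 2)) := rfl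
  rw [e]
  exact h

/-- `f_α` is continuous on `(0, 4)`. [bookkeeping] -/
theorem continuousAt_planarF (α : ℝ) {x : ℝ} (hx0 : 0 < x) (hx4 : x < 4) : ContinuousAt (planarF α) x :=
  (hasDerivAt_planarF α hx0 hx4).continuousAt

/-- **`f_α′ ≥ 0` on `[1, 4/3]`, `0 ≤ α ≤ 1`:** `x^{−2} ≤ x^{−α/2−1}` (`x ≥ 1`), `((4 − x)/(3x))^{α−1} ≤ (3/2)^{1−α} ≤ 3/2`
(`(4 − x)/(3x) ≥ 2/3`), and `2(1 − 4α) ≤ 2(1 − α)`. [ours] -/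
theorem deriv_planarF_nonneg {α : ℝ} (hα0 : 0 ≤ α) (hα1 : α ≤ 1) {x : ℝ} (hx1 : 1 ≤ x) (hx2 : x ≤ 4 / 3) :
    0 ≤ (1 - 4 * α) / 3 * (-(4 / (3 * x ^ 2)) * α * ((4 - x) / (3 * x)) ^ (α - 1)) -
        4 * (1 - α) / 3 * (-(α / 2) * x ^ (-(α / 2) - 1)) := by
  have hx0 : 0 < x := by linarith
  set r : ℝ := (4 - x) / (3 * x) with hr
  have hr23 : 2 / 3 ≤ r := by rw [hr, le_div_iff₀ (by linarith)]; linarith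
  have hr0 : 0 < r := by linarith
  set Rr : ℝ := r ^ (α - 1) with hRr
  set X1 : ℝ := x ^ (-(α / 2) - 1) with hX1
  have hRr0 : 0 ≤ Rr := Real.rpow_nonneg hr0.le _
  have hX10 : 0 < X1 := Real.rpow_pos_of_pos hx0 _
  -- `Rr ≤ (2/3)^(α-1) ≤ 3/2`
  have hRr1 : Rr ≤ 3 / 2 := by
    have h1 : Rr ≤ (2 / 3 : ℝ) ^ (α - 1) := Real.rpow_le_rpow_of_nonpos (by norm_num) hr23 (by linarith)
    have h2 : (2 / 3 : ℝ) ^ (α - 1) ≤ (2 / 3 : ℝ) ^ (-1 : ℝ) :=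
      Real.rpow_le_rpow_of_exponent_ge (by norm_num) (by norm_num) (by linarith)
    rw [Real.rpow_neg_one] at h2
    linarith [h1, h2, show ((2 : ℝ) / 3)⁻¹ = 3 / 2 by norm_num]
  -- `x^{-2} ≤ X1`
  have hX : 1 / x ^ 2 ≤ X1 := by
    have h : (x : ℝ) ^ (-(2 : ℝ)) ≤ x ^ (-(α / 2) - 1) :=
      Real.rpow_le_rpow_of_exponent_le hx1 (by linarith)
    rw [Real.rpow_neg hx0.le, show (2 : ℝ) = ((2 : ℕ) : ℝ) by norm_num, Real.rpow_natCast] at h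
    rw [one_div]; exact h
  -- rewrite the target as `α·[ (2(1-α)/3)·X1 − (4(1-4α)/9)·(1/x²)·Rr ] ≥ 0`
  have e : (1 - 4 * α) / 3 * (-(4 / (3 * x ^ 2)) * α * Rr) - 4 * (1 - α) / 3 * (-(α / 2) * X1) =
      α * (2 * (1 - α) / 3 * X1 - 4 * (1 - 4 * α) / 9 * (1 / x ^ 2) * Rr) := by
    field_simp; ring
  rw [e]
  refine mul_nonneg hα0 ?_
  -- case split on the sign of `1 - 4α`
  rcases le_or_gt (1 - 4 * α) 0 with hk | hk
  · -- `κ ≤ 0`: the subtracted term is ≤ 0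
    have : 4 * (1 - 4 * α) / 9 * (1 / x ^ 2) * Rr ≤ 0 :=
      mul_nonpos_of_nonpos_of_nonneg (mul_nonpos_of_nonpos_of_nonneg (by linarith) (by positivity)) hRr0
    nlinarith [hX10]
  · -- `κ > 0`: `(1/x²)·Rr ≤ X1·(3/2)` and `(4(1-4α)/9)(3/2) = 2(1-4α)/3 ≤ 2(1-α)/3`
    have h1 : (1 / x ^ 2) * Rr ≤ X1 * (3 / 2) := mul_le_mul hX hRr1 hRr0 hX10.le
    have h2 : 4 * (1 - 4 * α) / 9 * ((1 / x ^ 2) * Rr) ≤ 4 * (1 - 4 * α) / 9 * (X1 * (3 / 2)) :=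
      mul_le_mul_of_nonneg_left h1 (by linarith)
    nlinarith [h2, hX10, hα0]

/-- **`0 ≤ f_α(x)` on `[1, 4/3]` for `0 ≤ α ≤ 1`** (`f_α(1) = 0` and `f_α′ ≥ 0`, Mathlib
`monotoneOn_of_deriv_nonneg`). [ours] -/
theorem planarF_nonneg {α : ℝ} (hα0 : 0 ≤ α) (hα1 : α ≤ 1) {x : ℝ} (hx1 : 1 ≤ x) (hx2 : x ≤ 4 / 3) :
    0 ≤ planarF α x := by
  have hmono : MonotoneOn (planarF α) (Icc 1 (4 / 3)) := by
    refine monotoneOn_of_deriv_nonneg (convex_Icc _ _) ?_ ?_ ?_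
    · exact fun y hy => (continuousAt_planarF α (by linarith [hy.1]) (by linarith [hy.2])).continuousWithinAt
    · intro y hy
      rw [interior_Icc] at hy
      exact (hasDerivAt_planarF α (by linarith [hy.1]) (by linarith [hy.2])).differentiableAt.differentiableWithinAt
    · intro y hy
      rw [interior_Icc] at hy
      rw [(hasDerivAt_planarF α (by linarith [hy.1]) (by linarith [hy.2])).deriv]
      exact deriv_planarF_nonneg hα0 hα1 hy.1.le hy.2.le
  have h := hmono ⟨le_rfl, by norm_num⟩ ⟨hx1, hx2⟩ hx1
  rwa [planarF_one] at h

/-- **(W) at the planar share on the sector, every `1 < q ≤ 2`:** `0 ≤ lineT q (c_pl q) u` for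
`u ∈ (1/3, 2/3)`. In the closed form (with `α = 2 − q`, `p = u(1 − u)`, `A = 2^{1−q/2}`): W2 bounds the
`(2 − q)`-term by `(2 − q)A²s^{q−2}`; W1 bounds `u^{q−2} + (1 − u)^{q−2}` by `2^{1−α}p^{−α}`; what remains,
divided by `p^{−α}`, is `f_α(2s) ≥ 0` (`planarF_nonneg`, `2s ∈ [1, 4/3]` on the sector, `2p/s = (4 − 2s)/(6s)`).
Supersedes `lineT_cPlanar_nonneg` (`q ≤ 7/4`, there on all of `(0, 1)`) on the sector. [ours] -/
theorem lineT_cPlanar_nonneg_sector {q : ℝ} (hq : 1 < q) (hq2 : q ≤ 2) {u : ℝ} (hu1 : 1 / 3 < u)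
    (hu2 : u < 2 / 3) : 0 ≤ lineT q (cPlanar q) u := by
  have hu0 : 0 < u := by linarith
  have hu1' : u < 1 := by linarith
  have hv0 : 0 < 1 - u := by linarith
  have hs0 := lineNsq_pos u
  rw [lineT_closed_form q (cPlanar q) hu0 hu1']
  set c := cPlanar q with hc
  set p := u * (1 - u) with hp
  set s := lineNsq u with hs
  set P := p ^ (q - 2) with hP
  set S2 := s ^ (q - 2) with hS2
  set A := (2 : ℝ) ^ (1 - q / 2) with hA
  have hp0 : 0 < p := mul_pos hu0 hv0
  have hA0 : 0 < A := Real.rpow_pos_of_pos two_pos _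
  have hP0 : 0 < P := Real.rpow_pos_of_pos hp0 _
  have hS20 : 0 < S2 := Real.rpow_pos_of_pos hs0 _
  have hc' : c = (q - 1) / 3 * A := by rw [hc, cPlanar]
  have hc0 : 0 < c := by rw [hc']; exact mul_pos (by linarith) hA0 |>.trans_le' le_rfl
  have hA2 : A ^ 2 = (2 : ℝ) ^ (2 - q) := by
    rw [hA, ← Real.rpow_mul_natCast (by norm_num : (0 : ℝ) ≤ 2)]; congr 1; push_cast; ring
  have hAinv : (2 : ℝ) ^ (q - 2) = (A ^ 2)⁻¹ := by
    rw [hA2, ← Real.rpow_neg (by norm_num : (0 : ℝ) ≤ 2)]; congr 1; ring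
  -- the sector in the variable `x = 2s ∈ [1, 4/3]`; `s = 2 - 6p`
  have hsp : s = 2 - 6 * p := by rw [hs, hp]; unfold lineNsq; ring
  have hs12 : 1 / 2 ≤ s := by rw [hs]; unfold lineNsq; nlinarith [sq_nonneg (u - 1 / 2)]
  have hs23 : s < 2 / 3 := by rw [hs]; unfold lineNsq; nlinarith
  -- term3 ≤ (2-q) A² S2  (W2)
  have h3 : 3 * c * (2 - q) * (u ^ q + (1 - u) ^ q) * s ^ (q / 2 - 2) ≤ (q - 1) * (2 - q) * (A ^ 2 * S2) := by
    have hW2 := sum_rpow_le_lineNsq hq.le hq2 hu0.le hu1'.le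
    rw [← hA, ← hs] at hW2
    have hcoef : 0 ≤ 3 * c * (2 - q) := by
      have : 0 ≤ 2 - q := by linarith
      positivity
    have hss : s ^ (q / 2) * s ^ (q / 2 - 2) = S2 := by rw [hS2, ← Real.rpow_add hs0]; congr 1; ring
    calc 3 * c * (2 - q) * (u ^ q + (1 - u) ^ q) * s ^ (q / 2 - 2)
        ≤ 3 * c * (2 - q) * (A * s ^ (q / 2)) * s ^ (q / 2 - 2) :=
          mul_le_mul_of_nonneg_right (mul_le_mul_of_nonneg_left hW2 hcoef) (Real.rpow_nonneg hs0.le _)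
      _ = (q - 1) * (2 - q) * (A ^ 2 * S2) := by rw [← hss, hc']; ring
  -- term4 ≤ (4(q-1)²/3) · 2^{-α/2} · s^{-α/2} · P  (W1 only, keeping `s^{q/2-1}` exact)
  have hW1 := sum_rpow_sub_two_le hq.le hq2 hu0 hu1'
  rw [← hp, ← hP, hAinv] at hW1
  -- hW1 : u^(q-2) + (1-u)^(q-2) ≤ 2 (A²)⁻¹ P
  have h4 : 2 * c * (q - 1) * (u ^ (q - 2) + (1 - u) ^ (q - 2)) * s ^ (q / 2 - 1) ≤
      4 * (q - 1) ^ 2 / 3 * (A⁻¹ * s ^ (q / 2 - 1)) * P := by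
    have hcoef : 0 ≤ 2 * c * (q - 1) := by positivity
    calc 2 * c * (q - 1) * (u ^ (q - 2) + (1 - u) ^ (q - 2)) * s ^ (q / 2 - 1)
        ≤ 2 * c * (q - 1) * (2 * (A ^ 2)⁻¹ * P) * s ^ (q / 2 - 1) :=
          mul_le_mul_of_nonneg_right (mul_le_mul_of_nonneg_left hW1 hcoef) (Real.rpow_nonneg hs0.le _)
      _ = 4 * (q - 1) ^ 2 / 3 * (A⁻¹ * s ^ (q / 2 - 1)) * P := by rw [hc']; field_simp; ring
  -- the one-variable inequality at x = 2s: (4/3)(1-α) x^{-α/2} ≤ 1 + ((1-4α)/3) (2p/s)^α, α = 2 - q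
  have hx1 : (1 : ℝ) ≤ 2 * s := by linarith
  have hx2 : 2 * s ≤ 4 / 3 := by linarith
  have hF := planarF_nonneg (by linarith : (0 : ℝ) ≤ 2 - q) (by linarith : 2 - q ≤ 1) hx1 hx2
  -- identify the pieces of `planarF (2-q) (2s)` with `A`, `S2`, `P`
  have e1 : ((4 - 2 * s) / (3 * (2 * s))) ^ (2 - q) * P = A ^ 2 * S2 := by
    have hps : (4 - 2 * s) / (3 * (2 * s)) = 2 * p / s := by rw [hsp]; field_simp; ring
    rw [hps, Real.div_rpow (by positivity) hs0.le, Real.mul_rpow (by norm_num) hp0.le, hA2, hS2, hP]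
    have hinv : p ^ (2 - q) * p ^ (q - 2) = 1 := by
      rw [← Real.rpow_add hp0, show 2 - q + (q - 2) = 0 by ring, Real.rpow_zero]
    have hsinv : s ^ (q - 2) = (s ^ (2 - q))⁻¹ := by
      rw [← Real.rpow_neg hs0.le]; congr 1; ring
    rw [hsinv]; field_simp; linear_combination hinv
  have e2 : (2 * s) ^ (-((2 - q) / 2)) = A⁻¹ * s ^ (q / 2 - 1) := by
    rw [Real.mul_rpow (by norm_num) hs0.le, hA, ← Real.rpow_neg (by norm_num : (0 : ℝ) ≤ 2)]
    congr 1 <;> congr 1 <;> ring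
  have key : 4 * (1 - (2 - q)) / 3 * (A⁻¹ * s ^ (q / 2 - 1)) * P ≤ P + (1 - 4 * (2 - q)) / 3 * (A ^ 2 * S2) := by
    have h := mul_le_mul_of_nonneg_right hF hP0.le
    rw [zero_mul] at h
    simp only [planarF] at h
    rw [← e2, ← e1]
    linarith [h]
  have hbr : 0 ≤ (q - 1) * P + 3 * c ^ 2 * S2
      - 3 * c * (2 - q) * (u ^ q + (1 - u) ^ q) * s ^ (q / 2 - 2)
      - 2 * c * (q - 1) * (u ^ (q - 2) + (1 - u) ^ (q - 2)) * s ^ (q / 2 - 1) := by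
    have h2 : 3 * c ^ 2 * S2 = (q - 1) ^ 2 / 3 * (A ^ 2 * S2) := by rw [hc']; ring
    have hq1 : 0 < q - 1 := by linarith
    -- (q-1)·[P + ((q-1)/3)A²S2 − (2−q)A²S2 − (2/3)(q−1)A⁻¹s^{q/2−1}P·2] ≥ 0 via key
    have key' := mul_le_mul_of_nonneg_left key hq1.le
    linarith [h2, h3, h4, key']
  exact mul_nonneg (sq_nonneg q) hbr

end TopEig

end Summit.NavierStokesRegularity.FunctionalMining

end
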